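import Literature.AlgebraicGeometry.ShimuraVarieties.UnitaryCurveAuxiliaryComplexStructure
import Literature.AlgebraicGeometry.ShimuraVarieties.UnitaryCurveAuxiliarySymplecticAdelicV
import HarnessLib

/-!
# Equivariance of the frame-free complex structure `J_Φ(v)` under `U(H)(L⁺)`, IN ANY RANK `n`:
# `J_Φ(γ^τ v) = ũ(γ, 1)_ℝ · J_Φ(v) · ũ(γ, 1)_ℝ⁻¹` (Deligne 1979, Prop. 2.3.10; Milne 2005, Lemma 5.13)

Topic `AlgebraicGeometry/ShimuraVarieties`; namespace `Literature.AlgebraicGeometry.ShimuraVarieties.UnitaryCurve.AuxV`.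
THEOREMS ONLY (no definition — the real transport `X_γ := GL(ℚ ⊗ M → ℝ ⊗ M)(unitaryToTensorRat γ)` of `γ ∈ U(H)(L⁺)` is spelled out —,
no named fact, no instance, no notation, nothing asserted; net debt 0).
Cell `hodgecm-mathlib` (D-0151), FLOOR 0, P6 «MOD programme», door (E) of `stub_RGD`, organ **E2 FILE A4** (census
`F0/P6/A-p17/g27/CENSUS-E2-UnitaryCurveAuxiliaryPeriodMap.v1.A-p17g27.md`, split 2026-09-01T21:58:07Z «(J-rat)»; second hand A-p14 (g33)):
the rank-`n`, `W₀`-FREE and FRAME-FREE twin of ★ `UnitaryAuxiliaryComplexStructureEquivariance` (rank 3, ball model, frame `T`),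
over ★ E2 FILE A1 `UnitaryCurveAuxiliaryLineReflection` (`formH`, `projH`, `reflH`), ★ A2 `UnitaryCurveAuxiliaryComplexStructure`
(`sCompV`, `sMatV`, `sPhiV`, `auxComplexStructureVGL`, `auxComplexStructureV`) and ★ E1 `UnitaryCurveAuxiliarySymplecticModuleV` ∕
`…AdelicV` (`auxRepV`, `map_auxRepV`, `auxToGspRatV`, `unitaryToTensorRat`).  It supplies the hypothesis `hJrat` of ★ E3
`UnitaryCurveSiegelPointMap.siegelShimuraSet_mk_eq_of_gs_mk_eq` ∕ `exists_siegelPointMapGS` and of ★ `UnitaryCurveSiegelPointSeparation`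
with `J := auxComplexStructureV F τ Φ`, `bq γ := auxToGspRatV F (γ, 1)` (`ratToGLℂ L J⋆ τ γ = GL(τ) γ` by `rfl`).
`--supports stmt-HodgeConjecture-24832`, count-neutral; HC_CM is proved only modulo the printed citations until rung 0 closes.

The argument (every step PROVED here; points are vectors `v ∈ ℂⁿ`, `γ ∈ U(H)(L⁺)` acts by `γ^τ = GL(τ) γ`):
* §1 `formH_mulVec_of_unitary`, `projH_mulVec_of_unitary`, **`reflH_mulVec_of_unitary`**, `reflH_map_mulVec` — for ANY hermitian
  Gram matrix `Hc` on any finite index type, the `Hc`-projection onto ∕ reflection in the line `ℂw` is `U(Hc)`-EQUIVARIANT: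
  `r_{g w} = g r_w g⁻¹` for `gᴴ Hc g = Hc` (unconditional in `w`).
* §2 `conjTranspose_map_mul_map_rational` (`γ^τ ∈ U(H^τ)`), `coe_map_unitaryToTensorRat_apply` ∕ `map_realEmb_map_unitaryToTensorRat` (the
  `ρ`-component of `X_γ` is `γ^{ρ∘j}`), **`sMatV_map_mulVec`** ∕ **`sPhiV_map_mulVec`**: `s_{γ^τ v} = X_γ s_v X_γ⁻¹` in `GL_n(ℝ ⊗_ℚ M)` —
  componentwise at each `ρ ∈ Φ` (★ `matrix_eq_of_realEmb_eq`): §1 over `τ`, `1 = γ 1 γ⁻¹` elsewhere.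
* §3 **`coe_gspRationalToReal_auxToGspRatV_one`** — the real square `(gspRationalToReal δ (auxToGspRatV F (γ,1)) : GL) =
  auxRepV ℝ F (1, X_γ)` (★ `map_auxRepV (Algebra.ofId ℚ ℝ)`), and **`auxComplexStructureV_map_mulVec`**:
  `J_Φ(γ^τ v) = conjJ (gspRationalToReal δ (auxToGspRatV F (γ, 1))) (J_Φ(v))`; `coe_gspRationalToReal_auxToGspRatV_torus`,
  **`auxComplexStructureV_torus_invariant`** (`conjJ (ũ(1, m)_ℝ) J = J` for `m ∈ T₀(M)(ℚ)`), the combined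
  `auxComplexStructureV_map_mulVec_torus`, and the E3-shaped export **`auxComplexStructureV_hJrat`**.

## References
* [Deligne1979ShimuraVarieties] P. Deligne, *Variétés de Shimura* (1979), Prop. 2.3.10 and 2.1.2 (PDF pp. 32, 24 of Milne's
  translation: the morphism of Shimura data `(G, X) → (CSp(V), S^±)` is `G(ℝ)`-equivariant on `X` by construction, `h ↦ ad(g) ∘ h`).
* [Milne2005ShimuraVarieties] J. S. Milne, *Introduction to Shimura varieties* (2005), Lemma 5.13 p. 57, §6 p. 68 («`J ↦ gJg⁻¹`»).
* [RapoportSmithlingZhang2020Diagonal] M. Rapoport, B. Smithling, W. Zhang, Compos. Math. 156 (2020), Remark 3.2 (ii)(iii) pp. 9–10.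
* [Jacobowitz1990] H. Jacobowitz, *An introduction to CR structures* (1990), Ch. 2 §1 (pp. 40–41): reflections for a hermitian form.
-/

set_option autoImplicit false

noncomputable section

open Matrix NumberField
open scoped TensorProduct ComplexConjugate

namespace Literature.AlgebraicGeometry.ShimuraVarieties

namespace UnitaryCurve

namespace AuxV

open Literature.AlgebraicGeometry.ModuliOfAbelianVarieties
open Literature.AlgebraicGeometry.Motives (CMType)
open Literature.AlgebraicGeometry.ShimuraVarieties.UnitaryCanonicalModel.Aux (conjR conjR_tmul realEmb realEmb_tmul
  matrix_eq_of_realEmb_eq iPhi torusRat torusToTensorRat ratToTensor ratToTensor_apply)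
open Literature.AlgebraicGeometry.ShimuraVarieties.UnitaryCurve.Aux (unitaryToTensorRat)
open Literature.NumberTheory.Automorphic Literature.NumberTheory.Automorphic.UnitaryGroup

/-! ### §1. The `Hc`-reflection is `U(Hc)`-equivariant (any finite index type, any hermitian Gram matrix) -/

section ReflectionEquivariance

variable {m : Type} [Fintype m] [DecidableEq m] {Hc : Matrix m m ℂ} {g gi : Matrix m m ℂ}

omit [DecidableEq m] in
/-- `q(g w) = q(w)` for `g ∈ U(Hc)` (`gᴴ Hc g = Hc`). [cite: Jacobowitz1990, Ch. 2 §1 (p. 40)] -/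
theorem formH_mulVec_of_unitary (hg : gᴴ * Hc * g = Hc) (w : m → ℂ) : formH Hc (g *ᵥ w) = formH Hc w := by
  rw [formH, formH, Matrix.star_mulVec, Matrix.mulVec_mulVec, ← Matrix.dotProduct_mulVec, Matrix.mulVec_mulVec,
    ← Matrix.mul_assoc, hg]

/-- **`P_{g w} = g P_w g⁻¹` for `g ∈ U(Hc)`**: the `Hc`-orthogonal projection onto a line is `U(Hc)`-equivariant (unconditional in `w`:
both sides vanish when `q(w) = 0`). [cite: Deligne1979ShimuraVarieties, Prop. 2.3.10 (PDF p. 32)] [cite: Milne2005ShimuraVarieties, §6 p. 68] -/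
theorem projH_mulVec_of_unitary (hg : gᴴ * Hc * g = Hc) (h1 : g * gi = 1) (w : m → ℂ) :
    projH Hc (g *ᵥ w) = g * projH Hc w * gi := by
  have hgH : gᴴ * Hc = Hc * gi := by
    calc gᴴ * Hc = gᴴ * Hc * (g * gi) := by rw [h1, Matrix.mul_one]
      _ = Hc * gi := by rw [← Matrix.mul_assoc, hg]
  rw [projH, projH, formH_mulVec_of_unitary hg, Matrix.star_mulVec, Matrix.vecMul_vecMul, hgH, ← Matrix.vecMul_vecMul,
    ← Matrix.vecMulVec_mul, ← Matrix.mul_vecMulVec, Matrix.mul_smul, Matrix.smul_mul]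

/-- **`r_{g w} = g r_w g⁻¹` for `g ∈ U(Hc)`**: the `Hc`-reflection in a line is `U(Hc)`-equivariant.
[cite: Deligne1979ShimuraVarieties, Prop. 2.3.10 (PDF p. 32)] [cite: Milne2005ShimuraVarieties, §6 p. 68] -/
theorem reflH_mulVec_of_unitary (hg : gᴴ * Hc * g = Hc) (h1 : g * gi = 1) (w : m → ℂ) :
    reflH Hc (g *ᵥ w) = g * reflH Hc w * gi := by
  rw [reflH, reflH, projH_mulVec_of_unitary hg h1, Matrix.mul_sub, Matrix.sub_mul, Matrix.mul_one, h1, Matrix.mul_smul,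
    Matrix.smul_mul]

/-- The `GL` form: `r_{γ w} = γ r_w γ⁻¹` for `γ ∈ GL ∩ U(Hc)`. [cite: Deligne1979ShimuraVarieties, Prop. 2.3.10 (PDF p. 32)] -/
theorem reflH_map_mulVec (γ : GL m ℂ) (hγ : ((γ : Matrix m m ℂ))ᴴ * Hc * (γ : Matrix m m ℂ) = Hc) (w : m → ℂ) :
    reflH Hc ((γ : Matrix m m ℂ) *ᵥ w) = (γ : Matrix m m ℂ) * reflH Hc w * ((γ⁻¹ : GL m ℂ) : Matrix m m ℂ) :=
  reflH_mulVec_of_unitary hγ (by rw [← Units.val_mul, mul_inv_cancel, Units.val_one]) w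

end ReflectionEquivariance

/-! ### §2. Rational elements: `γ^τ ∈ U(H^τ)`, the transport `U(H)(ℚ) → GL_n(ℝ ⊗_ℚ M)`, and `s_{γ^τ v} = X_γ s_v X_γ⁻¹` -/

section Rational

variable {L : Type} [Field L] [NumberField L] [IsCMField L] {n : ℕ} {H : Matrix (Fin n) (Fin n) L} {τ : L →+* ℂ}

/-- **Rational elements are isometries of `H^τ`**: `(γ^τ)ᴴ H^τ γ^τ = H^τ` for `γ ∈ U(H)(L⁺)` (the defining equation `(cγ)ᵀ H γ = H` read
through `τ`, `τ ∘ c = conj ∘ τ`; rank-`n` twin of ★ `UnitaryCanonicalModel.conjTranspose_map_mul_map`). [cite: Milne2005ShimuraVarieties, Lemma 5.13 p. 57] -/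
theorem conjTranspose_map_mul_map_rational (γ : rational (↥(maximalRealSubfield L)) L (IsCMField.complexConj L) n H) :
    ((Matrix.GeneralLinearGroup.map τ (γ : GL (Fin n) L) : GL (Fin n) ℂ) : Matrix (Fin n) (Fin n) ℂ)ᴴ * H.map τ *
        ((Matrix.GeneralLinearGroup.map τ (γ : GL (Fin n) L) : GL (Fin n) ℂ) : Matrix (Fin n) (Fin n) ℂ) =
      H.map τ := by
  have hmem := map_mem_unitaryGroupOfForm (σ := ((IsCMField.complexConj L : L ≃ₐ[↥(maximalRealSubfield L)] L) :
      L →+* L)) (τ := starRingEnd ℂ) τ (fun x => IsCMField.complexEmbedding_complexConj L τ x) (J := H) γ.2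
  rw [mem_unitaryGroupOfForm_iff] at hmem
  have h2 : ((Matrix.GeneralLinearGroup.map τ (γ : GL (Fin n) L) : GL (Fin n) ℂ) : Matrix (Fin n) (Fin n) ℂ)ᴴ =
      (((Matrix.GeneralLinearGroup.map τ (γ : GL (Fin n) L) : GL (Fin n) ℂ) : Matrix (Fin n) (Fin n) ℂ).map
        (starRingEnd ℂ))ᵀ := by
    ext i k
    rfl
  rw [h2]
  exact hmem

/-- **The `H^τ`-reflection at `γ^τ v` is `γ^τ · r_v · (γ^τ)⁻¹`** for `γ ∈ U(H)(L⁺)`. [cite: Deligne1979ShimuraVarieties, Prop. 2.3.10 (PDF p. 32)]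
[cite: Milne2005ShimuraVarieties, Lemma 5.13 p. 57] -/
theorem reflH_rational_mulVec (γ : rational (↥(maximalRealSubfield L)) L (IsCMField.complexConj L) n H) (v : Fin n → ℂ) :
    reflH (H.map τ) (((Matrix.GeneralLinearGroup.map τ (γ : GL (Fin n) L) : GL (Fin n) ℂ) : Matrix (Fin n) (Fin n) ℂ) *ᵥ v) =
      ((Matrix.GeneralLinearGroup.map τ (γ : GL (Fin n) L) : GL (Fin n) ℂ) : Matrix (Fin n) (Fin n) ℂ) * reflH (H.map τ) v *
        (((Matrix.GeneralLinearGroup.map τ (γ : GL (Fin n) L))⁻¹ : GL (Fin n) ℂ) : Matrix (Fin n) (Fin n) ℂ) :=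
  reflH_map_mulVec _ (conjTranspose_map_mul_map_rational γ) v

end Rational

section Transport

variable {L : Type} [Field L] [NumberField L] [IsCMField L] (M : Type) [Field M] [NumberField M] (j : L →+* M)
  {n : ℕ} (H : Matrix (Fin n) (Fin n) L)

/-- Entries of the real transport `X_γ := GL(ℚ ⊗ M → ℝ ⊗ M) (unitaryToTensorRat γ)` of `γ ∈ U(H)(L⁺)`: `1 ⊗ j(γ_{ab})` (rank-`n` reading of ★
`UnitaryCanonicalModel.Aux.coe_unitaryToTensorReal_apply`; the transport is spelled out, no new definition). [cite: Deligne1979ShimuraVarieties, Prop. 2.3.10 (PDF p. 32)] -/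
theorem coe_map_unitaryToTensorRat_apply (γ : rational (↥(maximalRealSubfield L)) L (IsCMField.complexConj L) n H)
    (a b : Fin n) :
    (((Matrix.GeneralLinearGroup.map
        ((Algebra.TensorProduct.map (Algebra.ofId ℚ ℝ) (AlgHom.id ℚ M) : ℚ ⊗[ℚ] M →ₐ[ℚ] ℝ ⊗[ℚ] M) : ℚ ⊗[ℚ] M →+* ℝ ⊗[ℚ] M)
        (unitaryToTensorRat M j H γ)) : GL (Fin n) (ℝ ⊗[ℚ] M)) : Matrix (Fin n) (Fin n) (ℝ ⊗[ℚ] M)) a b =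
      (1 : ℝ) ⊗ₜ j (((γ : GL (Fin n) L) : Matrix (Fin n) (Fin n) L) a b) := by
  change Algebra.TensorProduct.map (Algebra.ofId ℚ ℝ) (AlgHom.id ℚ M) (ratToTensor M j _) = _
  rw [ratToTensor_apply, Algebra.TensorProduct.map_tmul, map_one, AlgHom.id_apply]
  rfl

/-- **The `ρ`-component of the real transport `X_γ` is `γ^{ρ∘j}`** (`ρ ∈ Φ`). [cite: Shimura1998, §6.2 Thm. 4, p. 44] -/
theorem map_realEmb_map_unitaryToTensorRat (Φ : CMType M) (ρ : Φ.1)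
    (γ : rational (↥(maximalRealSubfield L)) L (IsCMField.complexConj L) n H) :
    (((Matrix.GeneralLinearGroup.map
        ((Algebra.TensorProduct.map (Algebra.ofId ℚ ℝ) (AlgHom.id ℚ M) : ℚ ⊗[ℚ] M →ₐ[ℚ] ℝ ⊗[ℚ] M) : ℚ ⊗[ℚ] M →+* ℝ ⊗[ℚ] M)
        (unitaryToTensorRat M j H γ)) : GL (Fin n) (ℝ ⊗[ℚ] M)) : Matrix (Fin n) (Fin n) (ℝ ⊗[ℚ] M)).map (realEmb M Φ ρ) =
      ((Matrix.GeneralLinearGroup.map (ρ.1.comp j) (γ : GL (Fin n) L) : GL (Fin n) ℂ) : Matrix (Fin n) (Fin n) ℂ) := by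
  ext a b
  rw [Matrix.map_apply, coe_map_unitaryToTensorRat_apply, realEmb_tmul, Complex.ofReal_one, one_mul]
  rfl

/-- The `ρ`-component of `X_γ⁻¹` is `(γ^{ρ∘j})⁻¹`. [cite: Shimura1998, §6.2 Thm. 4, p. 44] -/
theorem map_realEmb_map_unitaryToTensorRat_inv (Φ : CMType M) (ρ : Φ.1)
    (γ : rational (↥(maximalRealSubfield L)) L (IsCMField.complexConj L) n H) :
    ((((Matrix.GeneralLinearGroup.map
        ((Algebra.TensorProduct.map (Algebra.ofId ℚ ℝ) (AlgHom.id ℚ M) : ℚ ⊗[ℚ] M →ₐ[ℚ] ℝ ⊗[ℚ] M) : ℚ ⊗[ℚ] M →+* ℝ ⊗[ℚ] M)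
        (unitaryToTensorRat M j H γ)))⁻¹ : GL (Fin n) (ℝ ⊗[ℚ] M)) : Matrix (Fin n) (Fin n) (ℝ ⊗[ℚ] M)).map (realEmb M Φ ρ) =
      (((Matrix.GeneralLinearGroup.map (ρ.1.comp j) (γ : GL (Fin n) L))⁻¹ : GL (Fin n) ℂ) : Matrix (Fin n) (Fin n) ℂ) := by
  rw [← map_inv, ← map_inv, ← map_inv]
  exact map_realEmb_map_unitaryToTensorRat M j H Φ ρ γ⁻¹

variable {M j H} (τ : L →+* ℂ) (Φ : CMType M)

/-- **`s_{γ^τ v} = X_γ · s_v · X_γ⁻¹` in `M_n(ℝ ⊗_ℚ M)`** (`X_γ = GL(ℚ ⊗ M → ℝ ⊗ M)(unitaryToTensorRat γ)`): componentwise at the `ρ ∈ Φ` over `τ` it is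
`reflH_rational_mulVec`, at the other `ρ ∈ Φ` it is `1 = γ·1·γ⁻¹`. [cite: Deligne1979ShimuraVarieties, Prop. 2.3.10 (PDF p. 32)]
[cite: Milne2005ShimuraVarieties, §6 p. 68] -/
theorem sMatV_map_mulVec (γ : rational (↥(maximalRealSubfield L)) L (IsCMField.complexConj L) n H) (v : Fin n → ℂ) :
    sMatV M j Φ τ H (((Matrix.GeneralLinearGroup.map τ (γ : GL (Fin n) L) : GL (Fin n) ℂ) : Matrix (Fin n) (Fin n) ℂ) *ᵥ v) =
      (((Matrix.GeneralLinearGroup.map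
        ((Algebra.TensorProduct.map (Algebra.ofId ℚ ℝ) (AlgHom.id ℚ M) : ℚ ⊗[ℚ] M →ₐ[ℚ] ℝ ⊗[ℚ] M) : ℚ ⊗[ℚ] M →+* ℝ ⊗[ℚ] M)
        (unitaryToTensorRat M j H γ)) : GL (Fin n) (ℝ ⊗[ℚ] M)) : Matrix (Fin n) (Fin n) (ℝ ⊗[ℚ] M)) *
        sMatV M j Φ τ H v *
        ((((Matrix.GeneralLinearGroup.map
        ((Algebra.TensorProduct.map (Algebra.ofId ℚ ℝ) (AlgHom.id ℚ M) : ℚ ⊗[ℚ] M →ₐ[ℚ] ℝ ⊗[ℚ] M) : ℚ ⊗[ℚ] M →+* ℝ ⊗[ℚ] M)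
        (unitaryToTensorRat M j H γ)))⁻¹ : GL (Fin n) (ℝ ⊗[ℚ] M)) : Matrix (Fin n) (Fin n) (ℝ ⊗[ℚ] M)) := by
  refine matrix_eq_of_realEmb_eq M Φ fun ρ => ?_
  rw [Matrix.map_mul, Matrix.map_mul, sMatV_map_realEmb, sMatV_map_realEmb, map_realEmb_map_unitaryToTensorRat,
    map_realEmb_map_unitaryToTensorRat_inv]
  by_cases h : ρ.1.comp j = τ
  · rw [sCompV_of_eq _ h, sCompV_of_eq _ h, h]
    exact reflH_rational_mulVec γ v
  · rw [sCompV_of_ne _ h, sCompV_of_ne _ h, Matrix.mul_one, ← Units.val_mul, mul_inv_cancel, Units.val_one]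

/-- **`s_{γ^τ v} = X_γ s_v X_γ⁻¹` in `GL_n(ℝ ⊗_ℚ M)`.** [cite: Deligne1979ShimuraVarieties, Prop. 2.3.10 (PDF p. 32)] -/
theorem sPhiV_map_mulVec (γ : rational (↥(maximalRealSubfield L)) L (IsCMField.complexConj L) n H) (v : Fin n → ℂ) :
    sPhiV M j Φ τ H (((Matrix.GeneralLinearGroup.map τ (γ : GL (Fin n) L) : GL (Fin n) ℂ) : Matrix (Fin n) (Fin n) ℂ) *ᵥ v) =
      (Matrix.GeneralLinearGroup.map
        ((Algebra.TensorProduct.map (Algebra.ofId ℚ ℝ) (AlgHom.id ℚ M) : ℚ ⊗[ℚ] M →ₐ[ℚ] ℝ ⊗[ℚ] M) : ℚ ⊗[ℚ] M →+* ℝ ⊗[ℚ] M)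
        (unitaryToTensorRat M j H γ)) * sPhiV M j Φ τ H v *
        ((Matrix.GeneralLinearGroup.map
        ((Algebra.TensorProduct.map (Algebra.ofId ℚ ℝ) (AlgHom.id ℚ M) : ℚ ⊗[ℚ] M →ₐ[ℚ] ℝ ⊗[ℚ] M) : ℚ ⊗[ℚ] M →+* ℝ ⊗[ℚ] M)
        (unitaryToTensorRat M j H γ)))⁻¹ := by
  apply Units.ext
  rw [coe_sPhiV, Units.val_mul, Units.val_mul, coe_sPhiV, sMatV_map_mulVec τ Φ γ v]

end Transport

/-! ### §3. The real square and the equivariance of `J_Φ` -/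

section Equivariance

variable {L : Type} [Field L] [NumberField L] [IsCMField L] {M : Type} [Field M] [NumberField M] [IsCMField M]
  {j : L →+* M} {n : ℕ} {H : Matrix (Fin n) (Fin n) L} {ξ : M} {g : ℕ} {δ : Fin g → ℕ}
  (F : SymplecticFrameV M j H ξ g δ) (τ : L →+* ℂ) (Φ : CMType M)

/-- **The real square** `GSp_δ(ℚ) → GSp_δ(ℝ)` ∘ `auxToGspRatV` = `auxRepV ℝ` ∘ (transport to `ℝ ⊗ M`), at a unitary element and trivial torus part:
`(gspRationalToReal δ (auxToGspRatV F (γ, 1)) : GL) = auxRepV ℝ F (1, X_γ)` (naturality ★ `map_auxRepV` along `ℚ → ℝ`).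
[cite: Deligne1979ShimuraVarieties, 2.1.2 (PDF p. 24)] [cite: Milne2005ShimuraVarieties, §5 (5.1) p. 56] -/
theorem coe_gspRationalToReal_auxToGspRatV_one (γ : rational (↥(maximalRealSubfield L)) L (IsCMField.complexConj L) n H) :
    (gspRationalToReal δ (auxToGspRatV F (γ, 1)) : GL (Fin g ⊕ Fin g) ℝ) =
      auxRepV ℝ F (1, (Matrix.GeneralLinearGroup.map
        ((Algebra.TensorProduct.map (Algebra.ofId ℚ ℝ) (AlgHom.id ℚ M) : ℚ ⊗[ℚ] M →ₐ[ℚ] ℝ ⊗[ℚ] M) : ℚ ⊗[ℚ] M →+* ℝ ⊗[ℚ] M)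
        (unitaryToTensorRat M j H γ))) := by
  rw [coe_gspRationalToReal, coe_auxToGspRatV, map_one]
  have h := map_auxRepV (Algebra.ofId ℚ ℝ) F (1 : (ℚ ⊗[ℚ] M)ˣ) (unitaryToTensorRat M j H γ)
  have hφ : ((Algebra.ofId ℚ ℝ : ℚ →ₐ[ℚ] ℝ) : ℚ →+* ℝ) = algebraMap ℚ ℝ := rfl
  rw [hφ] at h
  rw [h, map_one]

/-- **Equivariance of the complex structure, `GL` form**: `J_Φ(γ^τ v) = u · J_Φ(v) · u⁻¹` with `u = gspRationalToReal δ (auxToGspRatV F (γ, 1))`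
(`iPhi` is central, `s_{γ^τ v} = X_γ s_v X_γ⁻¹`, `auxRepV` is a homomorphism). [cite: Deligne1979ShimuraVarieties, Prop. 2.3.10, 2.1.2 (PDF pp. 32, 24)]
[cite: Milne2005ShimuraVarieties, §6 p. 68] -/
theorem auxComplexStructureVGL_map_mulVec (γ : rational (↥(maximalRealSubfield L)) L (IsCMField.complexConj L) n H) (v : Fin n → ℂ) :
    auxComplexStructureVGL F τ Φ (((Matrix.GeneralLinearGroup.map τ (γ : GL (Fin n) L) : GL (Fin n) ℂ) : Matrix (Fin n) (Fin n) ℂ) *ᵥ v) =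
      (gspRationalToReal δ (auxToGspRatV F (γ, 1)) : GL (Fin g ⊕ Fin g) ℝ) * auxComplexStructureVGL F τ Φ v *
        ((gspRationalToReal δ (auxToGspRatV F (γ, 1)))⁻¹ : GL (Fin g ⊕ Fin g) ℝ) := by
  rw [coe_gspRationalToReal_auxToGspRatV_one, auxComplexStructureVGL, auxComplexStructureVGL,
    sPhiV_map_mulVec τ Φ γ v, ← map_inv (auxRepV ℝ F), ← map_mul (auxRepV ℝ F), ← map_mul (auxRepV ℝ F),
    Prod.inv_mk, inv_one, Prod.mk_mul_mk, Prod.mk_mul_mk, one_mul, mul_one]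

/-- **(J-rat) Equivariance of the complex structure `J_Φ(v)` under `U(H)(L⁺)`** (σ2 currency ★ `conjJ`):
`J_Φ(γ^τ v) = conjJ (gspRationalToReal δ (auxToGspRatV F (γ, 1))) (J_Φ(v))` — with ★ `gspRationalToFinAdelic_auxToGspRatV` this is what makes
`[v, a] ↦ [J_Φ(v), ũ(a, t)]` well defined on the double cosets (★ `ShimuraSetGS.mk_eq_mk_iff` ∕ ★ `SiegelShimuraSet.mk_eq_mk_iff`; ★ E3
`UnitaryCurveSiegelPointMap`). [cite: Deligne1979ShimuraVarieties, Prop. 2.3.10, 2.1.2 (PDF pp. 32, 24)] [cite: Milne2005ShimuraVarieties, Lemma 5.13 p. 57, §6 p. 68] -/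
theorem auxComplexStructureV_map_mulVec (γ : rational (↥(maximalRealSubfield L)) L (IsCMField.complexConj L) n H) (v : Fin n → ℂ) :
    auxComplexStructureV F τ Φ (((Matrix.GeneralLinearGroup.map τ (γ : GL (Fin n) L) : GL (Fin n) ℂ) : Matrix (Fin n) (Fin n) ℂ) *ᵥ v) =
      conjJ (gspRationalToReal δ (auxToGspRatV F (γ, 1)) : GL (Fin g ⊕ Fin g) ℝ) (auxComplexStructureV F τ Φ v) := by
  rw [conjJ_def, auxComplexStructureV, auxComplexStructureV, auxComplexStructureVGL_map_mulVec F τ Φ γ v, Units.val_mul,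
    Units.val_mul]

/-- **The real square at a torus element**: `(gspRationalToReal δ (auxToGspRatV F (1, m)) : GL) = auxRepV ℝ F (m_ℝ, 1)`, `m_ℝ` the image of
`m ∈ T₀(M)(ℚ)` in `(ℝ ⊗_ℚ M)ˣ`. [cite: Deligne1979ShimuraVarieties, 2.1.2 (PDF p. 24)] -/
theorem coe_gspRationalToReal_auxToGspRatV_torus (m : torusRat M) :
    (gspRationalToReal δ (auxToGspRatV F (1, m)) : GL (Fin g ⊕ Fin g) ℝ) =
      auxRepV ℝ F (Units.map ((Algebra.TensorProduct.map (Algebra.ofId ℚ ℝ) (AlgHom.id ℚ M) :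
          ℚ ⊗[ℚ] M →ₐ[ℚ] ℝ ⊗[ℚ] M) : ℚ ⊗[ℚ] M →* ℝ ⊗[ℚ] M) (torusToTensorRat M m), 1) := by
  rw [coe_gspRationalToReal, coe_auxToGspRatV, map_one]
  have h := map_auxRepV (Algebra.ofId ℚ ℝ) F (torusToTensorRat M m) (1 : GL (Fin n) (ℚ ⊗[ℚ] M))
  have hφ : ((Algebra.ofId ℚ ℝ : ℚ →ₐ[ℚ] ℝ) : ℚ →+* ℝ) = algebraMap ℚ ℝ := rfl
  rw [hφ] at h
  rw [h, map_one]

/-- **Torus invariance of the complex structure**: `conjJ (ũ(1, m)_ℝ) (J_Φ(v)) = J_Φ(v)` for `m ∈ T₀(M)(ℚ)` — both components of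
`(m_ℝ, 1)·(iPhi, s_v)·(m_ℝ, 1)⁻¹` are unchanged, `(ℝ ⊗_ℚ M)ˣ` being commutative (the torus half of the well-definedness: changing the torus
representative by a rational element). [cite: Deligne1979ShimuraVarieties, Prop. 2.3.10, 2.1.2 (PDF pp. 32, 24)] [cite: Milne2005ShimuraVarieties, §6 p. 68] -/
theorem auxComplexStructureV_torus_invariant (m : torusRat M) (v : Fin n → ℂ) :
    conjJ (gspRationalToReal δ (auxToGspRatV F (1, m)) : GL (Fin g ⊕ Fin g) ℝ) (auxComplexStructureV F τ Φ v) =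
      auxComplexStructureV F τ Φ v := by
  rw [conjJ_def, coe_gspRationalToReal_auxToGspRatV_torus, auxComplexStructureV, auxComplexStructureVGL,
    ← map_inv (auxRepV ℝ F), ← Units.val_mul, ← Units.val_mul, ← map_mul (auxRepV ℝ F), ← map_mul (auxRepV ℝ F),
    Prod.inv_mk, inv_one, Prod.mk_mul_mk, Prod.mk_mul_mk, one_mul, mul_one, mul_inv_cancel_comm]

/-- **Equivariance under `U(H)(ℚ) × T₀(M)(ℚ)`** (both halves): `J_Φ(γ^τ v) = conjJ (ũ(γ, m)_ℝ) (J_Φ(v))` for every `m ∈ T₀(M)(ℚ)`.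
[cite: Deligne1979ShimuraVarieties, Prop. 2.3.10, 2.1.2 (PDF pp. 32, 24)] [cite: Milne2005ShimuraVarieties, Lemma 5.13 p. 57] -/
theorem auxComplexStructureV_map_mulVec_torus (γ : rational (↥(maximalRealSubfield L)) L (IsCMField.complexConj L) n H) (m : torusRat M)
    (v : Fin n → ℂ) :
    auxComplexStructureV F τ Φ (((Matrix.GeneralLinearGroup.map τ (γ : GL (Fin n) L) : GL (Fin n) ℂ) : Matrix (Fin n) (Fin n) ℂ) *ᵥ v) =
      conjJ (gspRationalToReal δ (auxToGspRatV F (γ, m)) : GL (Fin g ⊕ Fin g) ℝ) (auxComplexStructureV F τ Φ v) := by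
  have hsplit : auxToGspRatV F (γ, m) = auxToGspRatV F (1, m) * auxToGspRatV F (γ, 1) := by
    rw [← map_mul, Prod.mk_mul_mk, one_mul, mul_one]
  rw [hsplit, map_mul, Subgroup.coe_mul, conjJ_mul, ← auxComplexStructureV_map_mulVec F τ Φ γ v,
    auxComplexStructureV_torus_invariant]

/-- **(J-rat) in the binder shape of ★ E3** (`UnitaryCurveSiegelPointMap.siegelShimuraSet_mk_eq_of_gs_mk_eq` ∕ `…PointSeparation`: the hypothesis
`hJrat` with `J := auxComplexStructureV F τ Φ` and the rational companion `bq := (auxToGspRatV F) ∘ (γ ↦ (γ, 1))`; for `n = 2`,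
`ratToGLℂ L J⋆ τ γ` is `GL(τ) γ` by `rfl`).  Holds for every `v` (no cone hypothesis is needed). [cite: Deligne1979ShimuraVarieties, Prop. 2.3.10 (PDF p. 32)]
[cite: Milne2005ShimuraVarieties, Lemma 5.13 p. 57] -/
theorem auxComplexStructureV_hJrat (S : Set (Fin n → ℂ)) :
    ∀ (γ : ↥(rational (↥(maximalRealSubfield L)) L (IsCMField.complexConj L) n H)) (v : Fin n → ℂ), v ∈ S →
      auxComplexStructureV F τ Φ (((Matrix.GeneralLinearGroup.map τ (γ : GL (Fin n) L) : GL (Fin n) ℂ) : Matrix (Fin n) (Fin n) ℂ) *ᵥ v) =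
        conjJ ((gspRationalToReal δ (((auxToGspRatV F).comp (MonoidHom.inl _ _)) γ) : ↥(gspReal δ)) : GL (Fin g ⊕ Fin g) ℝ)
          (auxComplexStructureV F τ Φ v) :=
  fun γ v _ => auxComplexStructureV_map_mulVec F τ Φ γ v

end Equivariance

end AuxV

end UnitaryCurve

end Literature.AlgebraicGeometry.ShimuraVarieties

end
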